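import Literature.Geometry.Kaehler.NearlyHolomorphicCycleSupportFlat
import Literature.AlgebraicTopology.SingularHomology.LocallyFlatCriticalDegree
import HarnessLib

/-!
# The critical local homology at the good part of a nearly holomorphic cycle support is cyclic

Topic `Literature/Geometry/Kaehler`. Sequel to `NearlyHolomorphicCycleSupportFlat.lean` (the good
part `S ∖ Sg` of a nearly holomorphic cycle support `(S, Sg)` of codimension `p` is straightened,
near each of its points, by an open partial homeomorphism `M ⇀ ℝ^{2p} × K`). Feeding these charts,
restricted to the open subspace `M ∖ Sg`, to the tree's tubular-neighbourhood-free critical-degree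
theorem (`Literature.AlgebraicTopology.SingularHomology.exists_forall_mem_span_localHomologyOfSet_of_locallyFlat`,
file `SingularHomology/LocallyFlatCriticalDegree`: for `S` closed, preconnected and locally flat of
codimension `k ≥ 2` in a second countable space `X`, `H_k(X | S; R) = H_k(X, X ∖ S; R)` is `R · θ`
for one class `θ` — Hatcher §3.3, Voisin I §11.1.2 Lemma 11.13 without tubular neighbourhoods):

* `IsNearlyHolomorphicCycleSupport.exists_forall_mem_span_localHomologyOfSet` — **for a nearly
  holomorphic cycle support `(S, Sg)` of codimension `p ≥ 1` in a second countable complex manifold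
  `M`, the local homology `H_{2p}(M ∖ Sg | S ∖ Sg; R)` is spanned by one class.**

This is step (ii) of "the classes of `H²ᵖ(M)` dying off `S` form a line" for the threshold lemma
`ThresholdForcesHodgeType` of route *HolomorphicityRate* (Hodge summit): the remaining steps are
the vanishing of `H_q(M | Sg)`, `q ≤ 2p + 1` (`Sg` lies in an analytic set of real codimension
`≥ 2p + 2`), the long exact sequences of the triples `(M, M ∖ Sg, M ∖ S)` and duality over `ℂ`
(pattern of `HodgeTheory/SupportedClassesPurity`). Theorems only.

## References

* C. Voisin, *Hodge Theory and Complex Algebraic Geometry I* (2002), §11.1.2 Lemma 11.13.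
  [VoisinHodgeI2002]
* A. Hatcher, *Algebraic Topology* (2002), §3.3 Lemma 3.27, proof of Thm. 3.35. [HatcherAT2002]
-/

noncomputable section

open scoped Manifold ContDiff Topology
open Set Bundle Function

namespace Literature.Geometry.Kaehler

/-! ### The critical local homology of `M ∖ Sg` at `S ∖ Sg` is cyclic -/

section Critical

open Literature.AlgebraicTopology.SingularHomology TopologicalSpace

universe v

variable {E : Type} [NormedAddCommGroup E] [NormedSpace ℂ E] [FiniteDimensional ℂ E]
  {M : Type} [TopologicalSpace M] [ChartedSpace E M]

/-- **The local homology `H_{2p}(M ∖ Sg | S ∖ Sg; R)` of a nearly holomorphic cycle support is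
spanned by one class** (the topological Thom class of the good part). For a nearly holomorphic
cycle support `(S, Sg)` of codimension `p ≥ 1` in a second countable complex manifold `M`: the good
part `S ∖ Sg` is closed in the open subspace `M ∖ Sg`, preconnected, and locally flat of real
codimension `2p` there (`IsNearlyHolomorphicCycleSupport.exists_straightening`, restricted to the
open subtype), so the tree's tubular-neighbourhood-free critical-degree theorem
(`exists_forall_mem_span_localHomologyOfSet_of_locallyFlat`, Hatcher §3.3 / Voisin I Lemma 11.13)
applies. First step of "the classes supported on a nearly holomorphic cycle support form a line"
(threshold lemma of route *HolomorphicityRate*, Hodge summit).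
[cite: VoisinHodgeI2002, §11.1.2 Lemma 11.13] [cite: HatcherAT2002, §3.3 Lemma 3.27] -/
theorem IsNearlyHolomorphicCycleSupport.exists_forall_mem_span_localHomologyOfSet
    (R : Type v) [CommRing R] [SecondCountableTopology M]
    {g : RiemannianMetric (fun x : M ↦ TangentSpace 𝓘(ℝ, E) x)} {p : ℕ} {t : ℝ} {S Sg : Set M}
    (h : IsNearlyHolomorphicCycleSupport g p t S Sg) (hp : 1 ≤ p) :
    ∃ θ : localHomologyOfSet R R {x : M // x ∉ Sg} ((Subtype.val : {x : M // x ∉ Sg} → M) ⁻¹' S) (2 * p),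
      ∀ c, c ∈ Submodule.span R ({θ} : Set _) := by
  -- the open subspace `M ∖ Sg`
  let U : Opens M := ⟨Sgᶜ, h.isClosed_bad.isOpen_compl⟩
  haveI : SecondCountableTopology {x : M // x ∉ Sg} :=
    TopologicalSpace.Subtype.secondCountableTopology (Sgᶜ : Set M)
  have hS' : IsClosed ((Subtype.val : {x : M // x ∉ Sg} → M) ⁻¹' S) :=
    h.isClosed.preimage continuous_subtype_val
  have hpre : (Subtype.val : {x : M // x ∉ Sg} → M) ⁻¹' S =
      (Subtype.val : {x : M // x ∉ Sg} → M) ⁻¹' (S \ Sg) := by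
    ext z
    simp only [mem_preimage, mem_sdiff, iff_self_and]
    exact fun _ ↦ z.2
  have hSc' : IsPreconnected ((Subtype.val : {x : M // x ∉ Sg} → M) ⁻¹' S) := by
    rw [hpre]
    refine h.isConnected.isPreconnected.preimage_of_isOpenMap Subtype.val_injective
      h.isClosed_bad.isOpen_compl.isOpenMap_subtype_val ?_
    rintro z ⟨-, hz⟩
    exact ⟨⟨z, hz⟩, rfl⟩
  refine exists_forall_mem_span_localHomologyOfSet_of_locallyFlat R hS' hSc' (k := 2 * p) (by omega)
    fun x' hx' ↦ ?_
  -- straighten `S` near `x'` in `M`, then restrict the chart to the open subtype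
  have hx : (x' : M) ∈ S \ Sg := ⟨hx', x'.2⟩
  obtain ⟨F, _, _, _, K, _, _, e, hF, hxe, heS⟩ := h.exists_straightening hx
  have hne : Nonempty U := ⟨⟨x', x'.2⟩⟩
  refine ⟨F, inferInstance, inferInstance, inferInstance, K, inferInstance, inferInstance,
    e.subtypeRestr (s := U) hne, hF.ge, ?_, fun z hz ↦ ?_⟩
  · rw [OpenPartialHomeomorph.subtypeRestr_source]
    exact hxe
  · rw [OpenPartialHomeomorph.subtypeRestr_source] at hz
    exact heS z hz

end Critical

end Literature.Geometry.Kaehler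

end
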